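import Summits.CriticalPhenomena.Ising3DConformalLimit.Theses.PerfectScreening
import Summits.CriticalPhenomena.Ising3DConformalLimit.Theorems.CoulombImpliesNontrivial.Negative.Antecedent
import Summits.CriticalPhenomena.Ising3DConformalLimit.Theorems.CanonicalBranchRefutationCanonicalDimensionIsWick
import Summits.CriticalPhenomena.Ising3DConformalLimit.Theorems.CanonicalBranchRefutationIsingLimitHeritage

/-!
# `CoulombImpliesNontrivial` (item stmt-CriticalPhenomena-13885): the Coulomb branch of the route is FREE,
# and what the crux asks beyond `¬GFP⁺`

Line `CoulombBranchIsFree` of crux r3 (route PerfectScreening), lead a2; THEOREM-ONLY file (no new definitions: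
every statement below is spelled out in the tree's vocabulary, so that the tenure planner can paste the
signatures of `stub_moebiusForcesScreeningOfCrux` / `stub_closesOfMoebiusForcesScreening` into a `route edit`).
All results are compositions of LANDED theorems (crux-ideate round 2, ideator 5, file
`Cruxes/CoulombImpliesNontrivial/CoulombBranchIsFree.lean`, re-checked and extended by this seat):

* `coulomb_moebius_limit_wick` (**R1**): under the Coulomb antecedent EVERY Möbius-covariant non-degenerate
  pointwise limit of `criticalCorr 3` is Wick (`U₄ ≡ 0` off the diagonals): `moebiusDimension_eq_half_of_coulomb`
  (this crux's `Negative/Antecedent.lean`) + `IsingLimitHeritage_of_stubs` (stmt-15523) +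
  `CanonicalDimensionIsWick_of_stubs` (stmt-15520). So on the branch on which `PerfectScreening.closes` invokes r3
  (limits supplied by `MoebiusLimitExists`), the conclusion `HasNontrivialU4 S` of r3 is FALSE: r3 is used vacuously.
* `stub_moebiusForcesScreeningOfCrux` (**R2**): r3 ⟹ r3' := "a Möbius-covariant non-degenerate pointwise limit
  forces `NonSaturation`" (weak `η(3) > 0`, item stmt-1342).
* `stub_closesOfMoebiusForcesScreening` (**R3**): the route's deciding theorem re-proved with r3 REPLACED by the
  weaker r3' (other five hypotheses and the conclusion `Ising3DConformalLimit` unchanged).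
* `moebiusForcesScreening_iff_noFreeCoulombLimit` (**R4**): r3' ⟺ `¬GFP⁺` — "the massless free field with
  `Z > 0` is not a Möbius pointwise scaling limit of n.n. Ising₃" (the Wick clause is redundant by R1).
* `naiveNonMoebiusClause_iff_crux` (**R5, corrected**): the ideator's second conjunct
  `Coulomb → … → (∀ Δ, ¬ IsMoebiusCovariant Δ S) → HasNontrivialU4 S` is EQUIVALENT TO THE CRUX ITSELF, because
  `IsMoebiusCovariant` constrains `S` on coincident (junk) configurations too: changing `S₂` at ONE coincident pair
  makes any limit "Möbius for no `Δ`" without changing anything the crux reads. The faithful conjunct quantifies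
  over Möbius families agreeing with `S` on `NonCoincident`, and then (**R5'**, `crux_iff_moebiusForcesScreening_and_faithful`)
  `r3 ⟺ r3' ∧ (Coulomb → every non-degenerate limit NonCoincident-inequivalent to all Möbius families is interacting)`;
  the `⟸` half is the line's glue `stub_cruxOfMoebiusForcesScreening` (pure logic + transport of the limit along `EqOn`).
* Companion file `PerfectScreeningCoulombImpliesNontrivialCoulombBranchIsFreeShadows.lean`: the LATTICE SHADOWS of
  r3' (**R6**, ideator 5: massless free family sampled on `ℤ³`) and of the faithful second conjunct (**R7**, new:
  an ANISOTROPIC massless free family sampled on `ℤ³`) are both false — both halves need Ising dynamics, and the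
  second also contains "emergent conformality or interaction of every η = 0 limit", which the route never uses.
-/

noncomputable section

namespace Summit.CriticalPhenomena.Ising3DConformalLimit.PerfectScreeningCoulombImpliesNontrivial.CoulombBranchIsFree

open Literature.Probability.LatticeModels Filter Set
open Summit.CriticalPhenomena.Ising3DConformalLimit.Theses.PerfectScreening
open Summit.CriticalPhenomena.Ising3DConformalLimit.CoulombImpliesNontrivialNegative
open Summit.CriticalPhenomena.Ising3DConformalLimit.Cruxes
open scoped Topology RealInnerProductSpace

/-! ### Transport along `EqOn` on non-coincident configurations -/

/-- A pointwise scaling limit only sees the limit family ON `NonCoincident`. [folklore] -/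
theorem hasPointwiseScalingLimit_of_eqOn {G : LatticeCorrFamily 3} {ρ : ℝ → ℝ} {S S' : CorrFamily 3}
    (hlim : HasPointwiseScalingLimit G ρ S) (h : ∀ n, (NonCoincident 3 n).EqOn (S n) (S' n)) :
    HasPointwiseScalingLimit G ρ S' :=
  fun n => (hlim n).congr_right (h n)

/-- Non-degeneracy only sees `S₂` on `NonCoincident`. [folklore] -/
theorem isNondegenerateTwoPoint_of_eqOn {S S' : CorrFamily 3} (hnd : IsNondegenerateTwoPoint S)
    (h : (NonCoincident 3 2).EqOn (S 2) (S' 2)) : IsNondegenerateTwoPoint S' :=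
  fun x hx => h hx ▸ hnd x hx

/-- A pair extracted from a non-coincident quadruple is non-coincident. [folklore] -/
theorem pair_mem_of_mem_four {x : Fin 4 → EuclideanSpace ℝ (Fin 3)} (hx : x ∈ NonCoincident 3 4)
    {i j : Fin 4} (hij : i ≠ j) : (![x i, x j] : Fin 2 → EuclideanSpace ℝ (Fin 3)) ∈ NonCoincident 3 2 := by
  have hinj : Function.Injective x := hx
  exact pair_mem_nonCoincident fun h => hij (hinj h)

/-- `U₄` only reads `S` on non-coincident configurations. [folklore] -/
theorem limitConnectedFour_congr {S S' : CorrFamily 3}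
    (h2 : (NonCoincident 3 2).EqOn (S 2) (S' 2)) (h4 : (NonCoincident 3 4).EqOn (S 4) (S' 4))
    {x : Fin 4 → EuclideanSpace ℝ (Fin 3)} (hx : x ∈ NonCoincident 3 4) :
    limitConnectedFour S x = limitConnectedFour S' x := by
  simp only [limitConnectedFour]
  rw [h4 hx, h2 (pair_mem_of_mem_four hx (i := 0) (j := 1) (by decide)),
    h2 (pair_mem_of_mem_four hx (i := 2) (j := 3) (by decide)),
    h2 (pair_mem_of_mem_four hx (i := 0) (j := 2) (by decide)),
    h2 (pair_mem_of_mem_four hx (i := 1) (j := 3) (by decide)),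
    h2 (pair_mem_of_mem_four hx (i := 0) (j := 3) (by decide)),
    h2 (pair_mem_of_mem_four hx (i := 1) (j := 2) (by decide))]

/-- `HasNontrivialU4` is decided on non-coincident configurations. [folklore] -/
theorem hasNontrivialU4_of_eqOn {S S' : CorrFamily 3} (hU : HasNontrivialU4 S)
    (h : ∀ n, (NonCoincident 3 n).EqOn (S n) (S' n)) : HasNontrivialU4 S' := by
  obtain ⟨x, hx, hne⟩ := hU
  exact ⟨x, hx, by rwa [limitConnectedFour_congr (h 2) (h 4) hx] at hne⟩

/-! ### R1 — in the Coulomb world every Möbius non-degenerate limit is Wick -/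

/-- **R1. In the Coulomb world every Möbius-covariant non-degenerate pointwise limit of the critical Ising₃
correlators is Wick** (`U₄ ≡ 0` on non-coincident quadruples): the dimension is forced to `Δ = 1/2`
(`moebiusDimension_eq_half_of_coulomb`), every pointwise limit inherits axis reflection positivity, the GKS
pairings and Lebowitz (`IsingLimitHeritage_of_stubs`, stmt-15523), and at `Δ = (d-2)/2` such a Möbius family is
Wick (`CanonicalDimensionIsWick_of_stubs`, stmt-15520). [cite: Pohlmeyer1969, Theorem] -/
theorem coulomb_moebius_limit_wick
    (hC : ∃ c : ℝ, 0 < c ∧ ∀ x : Site 3, x ≠ 0 → c / ‖x‖ ≤ criticalTwoPoint 3 x)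
    {ρ : ℝ → ℝ} {Δ : ℝ} {S : CorrFamily 3}
    (hρ : ∀ δ ∈ Set.Ioc (0:ℝ) 1, 0 < ρ δ) (hlim : HasPointwiseScalingLimit (criticalCorr 3) ρ S)
    (hnd : IsNondegenerateTwoPoint S) (hM : IsMoebiusCovariant Δ S) :
    ∀ x ∈ NonCoincident 3 4, limitConnectedFour S x = 0 := by
  have hΔ : Δ = 1 / 2 := moebiusDimension_eq_half_of_coulomb hC hρ hlim hnd hM
  subst hΔ
  obtain ⟨hRP, hGKS, hLeb⟩ := IsingLimitHeritage.Birth.IsingLimitHeritage_of_stubs ρ S hρ hlim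
  exact CanonicalDimensionIsWick.Birth.CanonicalDimensionIsWick_of_stubs S ⟨criticalCorr 3, ρ, hlim⟩
    hRP hGKS hLeb hnd hM

/-- **R1'.** The conclusion `HasNontrivialU4 S` of r3 FAILS on every Möbius-covariant non-degenerate limit of the
Coulomb world — exactly the limits `PerfectScreening.closes` feeds to r3. [cite: Pohlmeyer1969, Theorem] -/
theorem coulomb_moebius_limit_not_hasNontrivialU4
    (hC : ∃ c : ℝ, 0 < c ∧ ∀ x : Site 3, x ≠ 0 → c / ‖x‖ ≤ criticalTwoPoint 3 x)
    {ρ : ℝ → ℝ} {Δ : ℝ} {S : CorrFamily 3}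
    (hρ : ∀ δ ∈ Set.Ioc (0:ℝ) 1, 0 < ρ δ) (hlim : HasPointwiseScalingLimit (criticalCorr 3) ρ S)
    (hnd : IsNondegenerateTwoPoint S) (hM : IsMoebiusCovariant Δ S) : ¬ HasNontrivialU4 S :=
  fun ⟨x, hx, hne⟩ => hne (coulomb_moebius_limit_wick hC hρ hlim hnd hM x hx)

/-! ### R2 — r3 implies r3' (`MoebiusForcesScreening`) -/

/-- **R2 (registered bookkeeping stub). r3 ⟹ r3'**: `CoulombImpliesNontrivial` implies that every Möbius-covariant
non-degenerate pointwise limit of `criticalCorr 3` forces `NonSaturation` (stmt-1342). Proof: if `NonSaturation`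
failed, the Coulomb antecedent would hold (`coulomb_iff_not_nonSaturation`), r3 would make the limit interacting,
and R1 makes it Wick. [folklore] -/
theorem stub_moebiusForcesScreeningOfCrux : Summit.CriticalPhenomena.Ising3DConformalLimit.Theses.PerfectScreening.CoulombImpliesNontrivial → ∀ (ρ : ℝ → ℝ) (Δ : ℝ) (S : CorrFamily 3), (∀ δ ∈ Set.Ioc (0:ℝ) 1, 0 < ρ δ) → HasPointwiseScalingLimit (criticalCorr 3) ρ S → IsNondegenerateTwoPoint S → IsMoebiusCovariant Δ S → Summit.CriticalPhenomena.Ising3DConformalLimit.Theses.PerfectScreening.NonSaturation := by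
  intro h ρ Δ S hρ hlim hnd hM
  by_contra hNS
  have hC := coulomb_iff_not_nonSaturation.2 hNS
  exact coulomb_moebius_limit_not_hasNontrivialU4 hC hρ hlim hnd hM (h hC ρ S hρ hlim hnd)

/-! ### R3 — the deciding theorem with r3 replaced by the weaker r3' -/

/-- **R3 (registered bookkeeping stub). The route's deciding theorem `PerfectScreening.closes` re-proved with
`CoulombImpliesNontrivial` REPLACED by the weaker r3'** (same other five hypotheses — items 1341, 13886, 1344, 1345,
1348 — and the same conclusion): on the Coulomb branch of the screening dichotomy r3' contradicts the antecedent
directly, with no appeal to `U₄`. Certified replacement glue for a `route edit`. [folklore] -/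
theorem stub_closesOfMoebiusForcesScreening : Summit.CriticalPhenomena.Ising3DConformalLimit.Theses.PerfectScreening.SubharmonicOffOrigin → (∀ (ρ : ℝ → ℝ) (Δ : ℝ) (S : CorrFamily 3), (∀ δ ∈ Set.Ioc (0:ℝ) 1, 0 < ρ δ) → HasPointwiseScalingLimit (criticalCorr 3) ρ S → IsNondegenerateTwoPoint S → IsMoebiusCovariant Δ S → Summit.CriticalPhenomena.Ising3DConformalLimit.Theses.PerfectScreening.NonSaturation) → Summit.CriticalPhenomena.Ising3DConformalLimit.Theses.PerfectScreening.GaussianLimitNotScreened → Summit.CriticalPhenomena.Ising3DConformalLimit.Theses.PerfectScreening.MoebiusLimitExists → Summit.CriticalPhenomena.Ising3DConformalLimit.Theses.PerfectScreening.GreenAsymptotics → Summit.CriticalPhenomena.Ising3DConformalLimit.Theses.PerfectScreening.ScreeningDichotomy → _root_.Ising3DConformalLimit := by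
  intro hSubH hMFS hGNS hMLE hGA hSD
  obtain ⟨ρ, Δ, S, hρ, hΔ, hlim, hnd, hM⟩ := hMLE
  refine ⟨ρ, Δ, S, hρ, hΔ, hlim, hnd, hM, ?_⟩
  by_contra hU4
  rcases hSD hGA hSubH with hCoulomb | hScreened
  · exact (coulomb_iff_not_nonSaturation.1 hCoulomb) (hMFS ρ Δ S hρ hlim hnd hM)
  · exact hGNS ρ Δ S hρ hlim hnd hM hU4 hScreened

/-! ### R4 — what r3' is: `¬GFP⁺` -/

/-- **R4. r3' ⟺ ¬GFP⁺**: r3' is exactly the exclusion of a Coulomb-normalised (`η = 0`, `Z > 0`) Möbius-covariant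
non-degenerate pointwise limit with `U₄ ≡ 0` — "the massless free field is not the conformal scaling limit of
n.n. Ising₃"; the Wick clause on the right is redundant by R1. [cite: Pohlmeyer1969, Theorem] -/
theorem moebiusForcesScreening_iff_noFreeCoulombLimit :
    (∀ (ρ : ℝ → ℝ) (Δ : ℝ) (S : CorrFamily 3), (∀ δ ∈ Set.Ioc (0:ℝ) 1, 0 < ρ δ) →
      HasPointwiseScalingLimit (criticalCorr 3) ρ S → IsNondegenerateTwoPoint S →
      IsMoebiusCovariant Δ S → NonSaturation) ↔
    ¬ ((∃ c : ℝ, 0 < c ∧ ∀ x : Site 3, x ≠ 0 → c / ‖x‖ ≤ criticalTwoPoint 3 x) ∧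
        ∃ (ρ : ℝ → ℝ) (Δ : ℝ) (S : CorrFamily 3), (∀ δ ∈ Set.Ioc (0:ℝ) 1, 0 < ρ δ) ∧
          HasPointwiseScalingLimit (criticalCorr 3) ρ S ∧ IsNondegenerateTwoPoint S ∧
          IsMoebiusCovariant Δ S ∧ ∀ x ∈ NonCoincident 3 4, limitConnectedFour S x = 0) := by
  constructor
  · rintro h ⟨hC, ρ, Δ, S, hρ, hlim, hnd, hM, -⟩
    exact (coulomb_iff_not_nonSaturation.1 hC) (h ρ Δ S hρ hlim hnd hM)
  · intro h ρ Δ S hρ hlim hnd hM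
    by_contra hNS
    have hC := coulomb_iff_not_nonSaturation.2 hNS
    exact h ⟨hC, ρ, Δ, S, hρ, hlim, hnd, hM, coulomb_moebius_limit_wick hC hρ hlim hnd hM⟩

/-! ### R5 — the line's glue, and the correction of the ideator's second conjunct -/

/-- **The line's glue (registered bookkeeping stub; `CoulombImpliesNontrivial_of` curried): r3' together with the
FAITHFUL non-Möbius clause — "under Coulomb, every non-degenerate limit that agrees on `NonCoincident` with NO
Möbius-covariant family is interacting" — gives the crux.** Pure logic plus transport of the limit hypotheses along
`EqOn`: if the limit `S` is NonCoincident-equivalent to a Möbius family `S'`, then `S'` is itself a non-degenerate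
Möbius pointwise limit, r3' yields `NonSaturation`, contradicting the antecedent; otherwise the clause applies. [folklore] -/
theorem stub_cruxOfMoebiusForcesScreening : (∀ (ρ : ℝ → ℝ) (Δ : ℝ) (S : CorrFamily 3), (∀ δ ∈ Set.Ioc (0:ℝ) 1, 0 < ρ δ) → HasPointwiseScalingLimit (criticalCorr 3) ρ S → IsNondegenerateTwoPoint S → IsMoebiusCovariant Δ S → Summit.CriticalPhenomena.Ising3DConformalLimit.Theses.PerfectScreening.NonSaturation) → ((∃ c : ℝ, 0 < c ∧ ∀ x : Site 3, x ≠ 0 → c / ‖x‖ ≤ criticalTwoPoint 3 x) → ∀ (ρ : ℝ → ℝ) (S : CorrFamily 3), (∀ δ ∈ Set.Ioc (0:ℝ) 1, 0 < ρ δ) → HasPointwiseScalingLimit (criticalCorr 3) ρ S → IsNondegenerateTwoPoint S → (∀ (Δ : ℝ) (S' : CorrFamily 3), IsMoebiusCovariant Δ S' → ¬ ∀ n, (NonCoincident 3 n).EqOn (S n) (S' n)) → HasNontrivialU4 S) → Summit.CriticalPhenomena.Ising3DConformalLimit.Theses.PerfectScreening.CoulombImpliesNontrivial := by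
  intro h₁ h₂ hC ρ S hρ hlim hnd
  by_cases hM : ∃ (Δ : ℝ) (S' : CorrFamily 3), IsMoebiusCovariant Δ S' ∧ ∀ n, (NonCoincident 3 n).EqOn (S n) (S' n)
  · obtain ⟨Δ, S', hM', heq⟩ := hM
    exact absurd (h₁ ρ Δ S' hρ (hasPointwiseScalingLimit_of_eqOn hlim heq)
      (isNondegenerateTwoPoint_of_eqOn hnd (heq 2)) hM') (coulomb_iff_not_nonSaturation.1 hC)
  · exact h₂ hC ρ S hρ hlim hnd (fun Δ S' hMS' heq => hM ⟨Δ, S', hMS', heq⟩)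

/-- Patching a family at coincident configurations: keep `S` on `NonCoincident`, put the value `1` elsewhere. [folklore] -/
theorem exists_patch_not_moebius
    (hC : ∃ c : ℝ, 0 < c ∧ ∀ x : Site 3, x ≠ 0 → c / ‖x‖ ≤ criticalTwoPoint 3 x)
    {ρ : ℝ → ℝ} {S : CorrFamily 3}
    (hρ : ∀ δ ∈ Set.Ioc (0:ℝ) 1, 0 < ρ δ) (hlim : HasPointwiseScalingLimit (criticalCorr 3) ρ S)
    (hnd : IsNondegenerateTwoPoint S) :
    ∃ S₁ : CorrFamily 3, (∀ n, (NonCoincident 3 n).EqOn (S n) (S₁ n)) ∧ ∀ Δ : ℝ, ¬ IsMoebiusCovariant Δ S₁ := by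
  classical
  refine ⟨fun n x => if x ∈ NonCoincident 3 n then S n x else 1, fun n x hx => by simp [hx], fun Δ hM => ?_⟩
  have hsc := hM.2.1
  -- the coincident pair `(0,0)`: scale covariance with factor 4 forces `4^{-2Δ} = 1`, i.e. `Δ = 0`
  have hcoin : (fun _ : Fin 2 => (0 : EuclideanSpace ℝ (Fin 3))) ∉ NonCoincident 3 2 := by
    intro h
    have hinj : Function.Injective (fun _ : Fin 2 => (0 : EuclideanSpace ℝ (Fin 3))) := h
    exact absurd (hinj (a₁ := 0) (a₂ := 1) rfl) (by decide)
  have h0 := hsc 2 4 (by norm_num) (fun _ : Fin 2 => (0 : EuclideanSpace ℝ (Fin 3)))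
  simp only [smul_zero] at h0
  rw [if_neg hcoin, mul_one] at h0
  have hΔ : Δ = 0 := by
    have h4 : (4:ℝ) ^ (-(2:ℝ) * Δ) = 1 := by exact_mod_cast h0.symm
    have := congrArg Real.log h4
    rw [Real.log_rpow (by norm_num), Real.log_one] at this
    have hl : Real.log 4 ≠ 0 := (Real.log_pos (by norm_num)).ne'
    have : (-(2:ℝ) * Δ) = 0 := by
      rcases mul_eq_zero.1 this with h | h
      · exact h
      · exact absurd h hl
    linarith
  subst hΔ
  -- the non-coincident pair `(0,e₀)`: `Δ = 0` says `S₂(2x) = S₂(x)`, the Coulomb world says `S₂(2x) = S₂(x)/2`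
  obtain ⟨hcov, -⟩ := canonical_of_coulomb hC hρ hlim hnd
  set x₀ : Fin 2 → EuclideanSpace ℝ (Fin 3) := ![0, EuclideanSpace.single (0 : Fin 3) (1:ℝ)] with hx₀
  have hx₀mem : x₀ ∈ NonCoincident 3 2 := refPair_mem_nonCoincident_three
  have h2mem : (fun i => (2:ℝ) • x₀ i) ∈ NonCoincident 3 2 := by
    have hinj : Function.Injective x₀ := hx₀mem
    intro i j hij
    exact hinj (smul_right_injective _ (by norm_num : (2:ℝ) ≠ 0) hij)
  have hpos : 0 < S 2 x₀ := hnd _ hx₀mem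
  have e₁ := hcov 2 2 two_pos x₀ hx₀mem
  have e₂ := hsc 2 2 two_pos x₀
  simp only at e₂
  rw [if_pos h2mem, if_pos hx₀mem, e₁] at e₂
  have h := mul_right_cancel₀ hpos.ne' e₂
  -- `h : 2 ^ (-(2:ℝ) * (1/2)) = 2 ^ (-(2:ℝ) * 0)`
  have h' : (2:ℝ) ^ (-(1:ℝ)) = (2:ℝ) ^ (0:ℝ) := by
    convert h using 2 <;> push_cast <;> ring
  rw [Real.rpow_neg_one, Real.rpow_zero] at h'
  norm_num at h'

/-- **R5 (correction). The ideator's second conjunct, as typed, IS the crux**: since `IsMoebiusCovariant` is a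
condition on ALL configurations, "Möbius for no `Δ`" can be forced by patching `S₂` at one coincident pair
(`exists_patch_not_moebius`) without changing the limit hypotheses or `U₄`; so the conjunct carries the full crux. [folklore] -/
theorem naiveNonMoebiusClause_iff_crux :
    ((∃ c : ℝ, 0 < c ∧ ∀ x : Site 3, x ≠ 0 → c / ‖x‖ ≤ criticalTwoPoint 3 x) →
      ∀ (ρ : ℝ → ℝ) (S : CorrFamily 3), (∀ δ ∈ Set.Ioc (0:ℝ) 1, 0 < ρ δ) →
        HasPointwiseScalingLimit (criticalCorr 3) ρ S → IsNondegenerateTwoPoint S →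
        (∀ Δ : ℝ, ¬ IsMoebiusCovariant Δ S) → HasNontrivialU4 S) ↔
    CoulombImpliesNontrivial := by
  constructor
  · intro h hC ρ S hρ hlim hnd
    obtain ⟨S₁, heq, hnM⟩ := exists_patch_not_moebius hC hρ hlim hnd
    have hU := h hC ρ S₁ hρ (hasPointwiseScalingLimit_of_eqOn hlim heq)
      (isNondegenerateTwoPoint_of_eqOn hnd (heq 2)) hnM
    exact hasNontrivialU4_of_eqOn hU fun n => (heq n).symm
  · intro h hC ρ S hρ hlim hnd _
    exact h hC ρ S hρ hlim hnd

/-- **R5'. The faithful decomposition**: r3 ⟺ r3' ∧ (Coulomb ⟹ every non-degenerate pointwise limit that agrees on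
`NonCoincident` with no Möbius-covariant family is interacting). (`⟸` is the glue `stub_cruxOfMoebiusForcesScreening`;
`⟹` is R2 and weakening.) [folklore] -/
theorem crux_iff_moebiusForcesScreening_and_faithful :
    CoulombImpliesNontrivial ↔
      ((∀ (ρ : ℝ → ℝ) (Δ : ℝ) (S : CorrFamily 3), (∀ δ ∈ Set.Ioc (0:ℝ) 1, 0 < ρ δ) →
          HasPointwiseScalingLimit (criticalCorr 3) ρ S → IsNondegenerateTwoPoint S →
          IsMoebiusCovariant Δ S → NonSaturation) ∧
        ((∃ c : ℝ, 0 < c ∧ ∀ x : Site 3, x ≠ 0 → c / ‖x‖ ≤ criticalTwoPoint 3 x) →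
          ∀ (ρ : ℝ → ℝ) (S : CorrFamily 3), (∀ δ ∈ Set.Ioc (0:ℝ) 1, 0 < ρ δ) →
            HasPointwiseScalingLimit (criticalCorr 3) ρ S → IsNondegenerateTwoPoint S →
            (∀ (Δ : ℝ) (S' : CorrFamily 3), IsMoebiusCovariant Δ S' →
              ¬ ∀ n, (NonCoincident 3 n).EqOn (S n) (S' n)) →
            HasNontrivialU4 S)) :=
  ⟨fun h => ⟨stub_moebiusForcesScreeningOfCrux h, fun hC ρ S hρ hlim hnd _ => h hC ρ S hρ hlim hnd⟩,
    fun ⟨h₁, h₂⟩ => stub_cruxOfMoebiusForcesScreening h₁ h₂⟩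

/-! ### R8 — r3' is an implication between two EXISTING items of the route: `MoebiusLimitExists → NonSaturation` -/

/-- **R8. r3' needs no new vocabulary**: it is equivalent to the implication `MoebiusLimitExists → NonSaturation`
between the route's own items r5 (stmt-1344) and stmt-1342. (`→`: instantiate; `←`: if `NonSaturation` failed the
Coulomb antecedent would hold and force `Δ = 1/2 > 0` (`moebiusDimension_eq_half_of_coulomb`), so the given Möbius
limit witnesses `MoebiusLimitExists`.) Hence the honest content of the Coulomb branch of `PerfectScreening.closes` is
"a conformal non-degenerate limit of Ising₃ forces weak `η(3) > 0`", an edge 1344 ⟹ 1342. [folklore] -/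
theorem moebiusForcesScreening_iff_moebiusLimitExists_imp_nonSaturation :
    (∀ (ρ : ℝ → ℝ) (Δ : ℝ) (S : CorrFamily 3), (∀ δ ∈ Set.Ioc (0:ℝ) 1, 0 < ρ δ) →
      HasPointwiseScalingLimit (criticalCorr 3) ρ S → IsNondegenerateTwoPoint S →
      IsMoebiusCovariant Δ S → NonSaturation) ↔ (MoebiusLimitExists → NonSaturation) := by
  constructor
  · rintro h ⟨ρ, Δ, S, hρ, -, hlim, hnd, hM⟩
    exact h ρ Δ S hρ hlim hnd hM
  · intro h ρ Δ S hρ hlim hnd hM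
    by_contra hNS
    have hC := coulomb_iff_not_nonSaturation.2 hNS
    have hΔ : Δ = 1 / 2 := moebiusDimension_eq_half_of_coulomb hC hρ hlim hnd hM
    exact hNS (h ⟨ρ, Δ, S, hρ, by rw [hΔ]; norm_num, hlim, hnd, hM⟩)

/-- **R8'. The deciding theorem with the edge `MoebiusLimitExists → NonSaturation` in place of r3** (composition of
R3 and R8): the five other hypotheses are the route's items 1341, 13886, 1344, 1345, 1348 verbatim. [folklore] -/
theorem closes_of_moebiusLimitExists_imp_nonSaturation : SubharmonicOffOrigin →
    (MoebiusLimitExists → NonSaturation) → GaussianLimitNotScreened → MoebiusLimitExists → GreenAsymptotics →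
    ScreeningDichotomy → _root_.Ising3DConformalLimit :=
  fun hSubH h => stub_closesOfMoebiusForcesScreening hSubH
    (moebiusForcesScreening_iff_moebiusLimitExists_imp_nonSaturation.2 h)

/-- **R8''. In fact on its own branch the route needs only `NonSaturation`-or-nothing**: given `MoebiusLimitExists`
(which `closes` assumes anyway), the replacement hypothesis is just `NonSaturation` itself — the rev-3 chain
(`NonSaturation ∧ GaussianLimitIsCoulomb ∧ MoebiusLimitExists ⇒ conjunct`, route docstring) re-derived from the rev-4
items: SubH + GreenAsymptotics + ScreeningDichotomy + NonSaturation empty the Coulomb branch, GaussianLimitNotScreened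
handles the screened one. [folklore] -/
theorem closes_of_nonSaturation : Summit.CriticalPhenomena.Ising3DConformalLimit.Theses.PerfectScreening.SubharmonicOffOrigin → Summit.CriticalPhenomena.Ising3DConformalLimit.Theses.PerfectScreening.NonSaturation → Summit.CriticalPhenomena.Ising3DConformalLimit.Theses.PerfectScreening.GaussianLimitNotScreened → Summit.CriticalPhenomena.Ising3DConformalLimit.Theses.PerfectScreening.MoebiusLimitExists → Summit.CriticalPhenomena.Ising3DConformalLimit.Theses.PerfectScreening.GreenAsymptotics → Summit.CriticalPhenomena.Ising3DConformalLimit.Theses.PerfectScreening.ScreeningDichotomy → _root_.Ising3DConformalLimit :=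
  fun hSubH hNS => closes_of_moebiusLimitExists_imp_nonSaturation hSubH (fun _ => hNS)

end Summit.CriticalPhenomena.Ising3DConformalLimit.PerfectScreeningCoulombImpliesNontrivial.CoulombBranchIsFree

end
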